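import Summits.RiemannHypothesis.RiemannHypothesis.Theorems.ThetaTier2Stage1
import HarnessLib

/-!
# THETA tier-2 kernel checker — the LAG ENVELOPE LIST `envList`, the pairwise maxima `emaxList`, the exact `dot` (cc-s2-1; RH-FREE)

(K4), list semantics, part 1 (HOME/cc-s2-1/gen22/TIER2-KERNEL-SPEC.md §2 «Cross term» / §5 (K4) / §6(c)).  For the run `stage1 A`:

* `envListN A = envList A (stage1 A)` has length `Kw + 1` (`envListN_length`, needs `Jt ≤ Kw + 1`); its real reading `envX A i := val (entry i)`
  IS `envE A i` on the depth cells `i < Jt` (`envX_eq_envE`) and dominates the geometric tail `z·E^i` on `Jt ≤ i ≤ Kw` for any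
  `z ≤ val zm1H`, `0 ≤ E ≤ val emhStep` (`envX_tail`: `geoTail` iterates `mulU` upward from `powU emhStep Jt`) — with `z = ζ(m+1)`,
  `E = e^{−(m+½)τ}` this is the E2 envelope `ζ(m+1)e^{−(m+½)t}` beyond depth `D = Jt·τ`;
* `emaxN A = emaxList (envListN A)` reads `val (entry j) = max (envX A (j−1)) (envX A j)` (ℕ-subtraction: entry `0` is `envX A 0`) (`val_emaxN`);
* `dot as bs 0 = Σ_{i < min |as| |bs|} as_i·bs_i` exactly (`dot_eq`), so `Σ val(as_i)·val(bs_i) ≤ val ⌈dot/S⌉` (`dot_sound`) — the inner sum of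
  the kernel's `H_k`.

The convolution loop, the hull, the `e^{w}`-integral and `crossTerm` are part 2 (`ThetaTier2Cross`).  Nothing here bears on the truth of RH.
-/

set_option linter.dupNamespace false  -- the mandated namespace repeats `RiemannHypothesis`
set_option autoImplicit false

namespace Summit.RiemannHypothesis.RiemannHypothesis.Theorems.ThetaTier2

open Real Finset

/-! ## `geoTail` -/

/-- `geoTail` with no fuel returns the accumulator. [this cell] -/
theorem geoTail_zero (A : Inp) (geo : ℕ) (acc : List ℕ) : geoTail A 0 geo acc = acc := by
  unfold geoTail; rfl

/-- One step of `geoTail`. [this cell] -/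
theorem geoTail_succ (A : Inp) (fuel geo : ℕ) (acc : List ℕ) :
    geoTail A (fuel + 1) geo acc = geoTail A fuel (mulU geo A.emhStep) (mulU A.zm1H geo :: acc) := by
  conv => lhs; unfold geoTail

/-- **`geoTail` is an upper geometric sequence**: started at `geo` with `0 ≤ x ≤ val geo`, entry `acc.length + j` (`j < fuel`) of the re-reversed output
dominates `z·x·E^j` for `z ≤ val zm1H`, `0 ≤ E ≤ val emhStep`; the accumulator stays in front; the length grows by `fuel`. [this cell] -/
theorem geoTail_sound (A : Inp) {z Em : ℝ} (hz : z ≤ val A.zm1H) (hE0 : 0 ≤ Em) (hE : Em ≤ val A.emhStep) :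
    ∀ (fuel geo : ℕ) (acc : List ℕ) (x : ℝ), 0 ≤ x → x ≤ val geo →
      (geoTail A fuel geo acc).length = fuel + acc.length ∧
      (∀ i < acc.length, (geoTail A fuel geo acc).reverse.getD i 0 = acc.reverse.getD i 0) ∧
      (∀ j < fuel, z * x * Em ^ j ≤ val ((geoTail A fuel geo acc).reverse.getD (acc.length + j) 0)) := by
  intro fuel
  induction fuel with
  | zero =>
    intro geo acc x _ _
    rw [geoTail_zero]
    exact ⟨by simp, fun i _ => rfl, fun j hj => absurd hj (Nat.not_lt_zero j)⟩
  | succ fuel ih =>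
    intro geo acc x hx0 hx
    rw [geoTail_succ]
    have hx' : x * Em ≤ val (mulU geo A.emhStep) := le_mulU hE0 hx hE
    obtain ⟨L, Old, New⟩ := ih (mulU geo A.emhStep) (mulU A.zm1H geo :: acc) (x * Em) (mul_nonneg hx0 hE0) hx'
    refine ⟨?_, ?_, ?_⟩
    · rw [L, List.length_cons]; omega
    · intro i hi
      rw [Old i (by rw [List.length_cons]; omega), getD_reverse_cons_of_lt hi]
    · intro j hj
      rcases j with _ | j
      · rw [pow_zero, mul_one, Nat.add_zero, Old acc.length (by rw [List.length_cons]; omega),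
          getD_reverse_cons_of_eq rfl]
        exact le_mulU hx0 hz hx
      · have h := New j (by omega)
        rw [List.length_cons, show acc.length + 1 + j = acc.length + (j + 1) by omega] at h
        rw [show z * x * Em ^ (j + 1) = z * (x * Em) * Em ^ j by ring]
        exact h

/-! ## `envList` for the run `stage1 A` -/

/-- The kernel's envelope list for the run `stage1 A` (`env_0 … env_Kw`). [this cell, TIER2-KERNEL-SPEC §2] -/
def envListN (A : Inp) : List ℕ := envList A (stage1 A)

/-- `envX A i = val env_i` — the real reading of the lag envelope (`0` past `Kw`). [this cell, TIER2-KERNEL-SPEC §5 (K4)] -/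
noncomputable def envX (A : Inp) (i : ℕ) : ℝ := val ((envListN A).getD i 0)

/-- `envX ≥ 0`. [this cell] -/
theorem envX_nonneg (A : Inp) (i : ℕ) : 0 ≤ envX A i := val_nonneg _

/-- `envListN A` unfolded. [this cell] -/
theorem envListN_eq (A : Inp) : envListN A =
    (stage1 A).eRev.reverse ++ (geoTail A (A.Kw + 1 - A.Jt) (powU A.emhStep A.Jt) []).reverse := by
  unfold envListN envList; rfl

/-- The geometric part has length `Kw + 1 − Jt`. [this cell] -/
theorem geoPart_length (A : Inp) : (geoTail A (A.Kw + 1 - A.Jt) (powU A.emhStep A.Jt) []).length = A.Kw + 1 - A.Jt := by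
  have h := (geoTail_sound A (z := 0) (Em := 0) (val_nonneg _) le_rfl (val_nonneg _) (A.Kw + 1 - A.Jt)
    (powU A.emhStep A.Jt) [] 0 le_rfl (val_nonneg _)).1
  simpa using h

/-- **`|envListN A| = Kw + 1`** (for `Jt ≤ Kw + 1`). [this cell] -/
theorem envListN_length (A : Inp) (hJK : A.Jt ≤ A.Kw + 1) : (envListN A).length = A.Kw + 1 := by
  rw [envListN_eq, List.length_append, List.length_reverse, List.length_reverse, (stage1_lengths A).2.1, geoPart_length]
  omega

/-- **On the depth cells the lag envelope IS the cell envelope**: `envX A i = envE A i` for `i < Jt`. [this cell, TIER2-KERNEL-SPEC §5 (K4)] -/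
theorem envX_eq_envE (A : Inp) {i : ℕ} (hi : i < A.Jt) : envX A i = envE A i := by
  unfold envX envE
  rw [envListN_eq, List.getD_eq_getElem?_getD, List.getD_eq_getElem?_getD,
    List.getElem?_append_left (by rw [List.length_reverse, (stage1_lengths A).2.1]; exact hi)]

/-- **Beyond depth `D` the lag envelope dominates the geometric tail**: `z·E^i ≤ envX A i` for `Jt ≤ i ≤ Kw`, any `z ≤ val zm1H`,
`0 ≤ E ≤ val emhStep`. [this cell, TIER2-KERNEL-SPEC §5 (K4)] -/
theorem envX_tail (A : Inp) {z Em : ℝ} (hz : z ≤ val A.zm1H) (hE0 : 0 ≤ Em) (hE : Em ≤ val A.emhStep)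
    {i : ℕ} (h1 : A.Jt ≤ i) (h2 : i ≤ A.Kw) : z * Em ^ i ≤ envX A i := by
  unfold envX
  rw [envListN_eq, List.getD_eq_getElem?_getD,
    List.getElem?_append_right (by rw [List.length_reverse, (stage1_lengths A).2.1]; exact h1),
    List.length_reverse, (stage1_lengths A).2.1, ← List.getD_eq_getElem?_getD]
  have hx : Em ^ A.Jt ≤ val (powU A.emhStep A.Jt) := le_powU hE0 hE _
  have h := (geoTail_sound A hz hE0 hE (A.Kw + 1 - A.Jt) (powU A.emhStep A.Jt) [] (Em ^ A.Jt) (pow_nonneg hE0 _) hx).2.2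
    (i - A.Jt) (by omega)
  rw [List.length_nil, Nat.zero_add, mul_assoc, ← pow_add, show A.Jt + (i - A.Jt) = i by omega] at h
  exact h

/-- The same in exponential form: `z·e^{−c·(iτ)} ≤ envX A i` for `e^{−cτ} ≤ val emhStep` (`c = m + ½`). [this cell] -/
theorem envX_tail_exp (A : Inp) {z c τ : ℝ} (hz : z ≤ val A.zm1H) (hE : exp (-c * τ) ≤ val A.emhStep)
    {i : ℕ} (h1 : A.Jt ≤ i) (h2 : i ≤ A.Kw) : z * exp (-c * ((i : ℝ) * τ)) ≤ envX A i := by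
  have h := envX_tail A hz (exp_pos _).le hE h1 h2
  rwa [← exp_nat_mul, show (i : ℝ) * (-c * τ) = -c * ((i : ℝ) * τ) by ring] at h

/-! ## `emaxList` -/

/-- One step of `emaxAux`. [this cell] -/
theorem emaxAux_cons (prev e : ℕ) (es acc : List ℕ) : emaxAux prev (e :: es) acc = emaxAux e es (max prev e :: acc) := by
  conv => lhs; unfold emaxAux

/-- `emaxAux` on the empty list. [this cell] -/
theorem emaxAux_nil (prev : ℕ) (acc : List ℕ) : emaxAux prev [] acc = acc := by
  unfold emaxAux; rfl

/-- **`emaxAux` computes the running pairwise maxima**: entry `acc.length + j` of the re-reversed output is `max ((prev :: es)_j) (es_j)`. [this cell] -/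
theorem emaxAux_sound : ∀ (es : List ℕ) (prev : ℕ) (acc : List ℕ),
    (emaxAux prev es acc).length = es.length + acc.length ∧
    (∀ i < acc.length, (emaxAux prev es acc).reverse.getD i 0 = acc.reverse.getD i 0) ∧
    (∀ j < es.length, (emaxAux prev es acc).reverse.getD (acc.length + j) 0 = max ((prev :: es).getD j 0) (es.getD j 0)) := by
  intro es
  induction es with
  | nil =>
    intro prev acc
    rw [emaxAux_nil]
    exact ⟨by simp, fun i _ => rfl, fun j hj => absurd hj (Nat.not_lt_zero j)⟩
  | cons e es ih =>
    intro prev acc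
    rw [emaxAux_cons]
    obtain ⟨L, Old, New⟩ := ih e (max prev e :: acc)
    refine ⟨?_, ?_, ?_⟩
    · rw [L, List.length_cons, List.length_cons]; omega
    · intro i hi
      rw [Old i (by rw [List.length_cons]; omega), getD_reverse_cons_of_lt hi]
    · intro j hj
      rcases j with _ | j
      · rw [Nat.add_zero, Old acc.length (by rw [List.length_cons]; omega), getD_reverse_cons_of_eq rfl,
          List.getD_cons_zero, List.getD_cons_zero]
      · have h := New j (by rw [List.length_cons] at hj; omega)
        rw [List.length_cons, show acc.length + 1 + j = acc.length + (j + 1) by omega] at h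
        rw [h, List.getD_cons_succ, List.getD_cons_succ]

/-- The kernel's pairwise-maximum list for the run. [this cell, TIER2-KERNEL-SPEC §2] -/
def emaxN (A : Inp) : List ℕ := emaxList (envListN A)

/-- **`emaxList` semantics** for a nonempty input: same length, entry `j` = `max (env_{j−1}) (env_j)` (ℕ-subtraction). [this cell] -/
theorem emaxList_spec (e0 : ℕ) (es : List ℕ) :
    (emaxList (e0 :: es)).length = (e0 :: es).length ∧
    ∀ j < (e0 :: es).length, (emaxList (e0 :: es)).getD j 0 = max ((e0 :: es).getD (j - 1) 0) ((e0 :: es).getD j 0) := by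
  have hdef : emaxList (e0 :: es) = (emaxAux e0 es [e0]).reverse := by unfold emaxList; rfl
  obtain ⟨L, Old, New⟩ := emaxAux_sound es e0 [e0]
  rw [hdef]
  refine ⟨by rw [List.length_reverse, L, List.length_cons, List.length_cons, List.length_nil], ?_⟩
  intro j hj
  rcases j with _ | j
  · rw [Old 0 (by simp)]; simp
  · have h := New j (by rw [List.length_cons] at hj; omega)
    rw [List.length_cons, List.length_nil, Nat.zero_add, Nat.add_comm] at h
    rw [h, show j + 1 - 1 = j from rfl, List.getD_cons_succ]

/-- `|emaxN A| = |envListN A|` and **`val (emaxN A)_j = max (envX A (j−1)) (envX A j)`** for `j < |envListN A|`. [this cell, TIER2-KERNEL-SPEC §5 (K4)] -/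
theorem val_emaxN (A : Inp) (hJK : A.Jt ≤ A.Kw + 1) :
    (emaxN A).length = (envListN A).length ∧
    ∀ j < (envListN A).length, val ((emaxN A).getD j 0) = max (envX A (j - 1)) (envX A j) := by
  have hlen := envListN_length A hJK
  unfold emaxN envX
  obtain ⟨e0, es, he⟩ : ∃ e0 es, envListN A = e0 :: es := by
    cases h : envListN A with
    | nil => rw [h] at hlen; simp at hlen
    | cons e0 es => exact ⟨e0, es, rfl⟩
  rw [he]
  obtain ⟨L, E⟩ := emaxList_spec e0 es
  exact ⟨L, fun j hj => by rw [E j hj, val_max]⟩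

/-! ## `dot` -/

/-- `dot [] bs acc = acc`. [this cell] -/
theorem dot_nil_left (bs : List ℕ) (acc : ℕ) : dot [] bs acc = acc := by
  unfold dot; rfl

/-- `dot (a :: as) [] acc = acc`. [this cell] -/
theorem dot_cons_nil (a : ℕ) (as : List ℕ) (acc : ℕ) : dot (a :: as) [] acc = acc := by
  unfold dot; rfl

/-- `dot (a :: as) (b :: bs) acc = dot as bs (acc + a·b)`. [this cell] -/
theorem dot_cons_cons (a b : ℕ) (as bs : List ℕ) (acc : ℕ) : dot (a :: as) (b :: bs) acc = dot as bs (acc + a * b) := by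
  conv => lhs; unfold dot

/-- **`dot` is the exact truncated dot product**: `dot as bs acc = acc + Σ_{i < min |as| |bs|} as_i·bs_i`. [this cell] -/
theorem dot_eq : ∀ (as bs : List ℕ) (acc : ℕ),
    dot as bs acc = acc + ∑ i ∈ range (min as.length bs.length), as.getD i 0 * bs.getD i 0 := by
  intro as
  induction as with
  | nil => intro bs acc; rw [dot_nil_left]; simp
  | cons a as ih =>
    intro bs acc
    cases bs with
    | nil => rw [dot_cons_nil]; simp
    | cons b bs =>
      rw [dot_cons_cons, ih, List.length_cons, List.length_cons, Nat.succ_min_succ, sum_range_succ']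
      simp only [List.getD_cons_succ, List.getD_cons_zero]
      ring

/-- **The rounded dot product bounds the real one**: `Σ_{i<min} val(as_i)·val(bs_i) ≤ val ⌈(dot as bs 0)/S⌉`. [this cell, TIER2-KERNEL-SPEC §2 (E4)] -/
theorem dot_sound (as bs : List ℕ) :
    ∑ i ∈ range (min as.length bs.length), val (as.getD i 0) * val (bs.getD i 0) ≤ val ((dot as bs 0 + (S - 1)) / S) := by
  have hS : (0 : ℝ) < (S : ℝ) := by rw [S_cast_eq]; positivity
  have hSpos : 0 < S := by rw [S_eq_two_pow]; positivity
  set D := ∑ i ∈ range (min as.length bs.length), as.getD i 0 * bs.getD i 0 with hD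
  have hdot : dot as bs 0 = D := by rw [dot_eq, Nat.zero_add]
  have hceil := le_mul_ceilDiv D S hSpos
  have e1 : ∑ i ∈ range (min as.length bs.length), val (as.getD i 0) * val (bs.getD i 0) = (D : ℝ) / ((S : ℝ) * (S : ℝ)) := by
    rw [hD]; push_cast; rw [sum_div]
    refine sum_congr rfl fun i _ => ?_
    unfold val; rw [div_mul_div_comm]
  rw [e1, hdot]
  unfold val
  rw [div_le_div_iff₀ (mul_pos hS hS) hS]
  have h' : ((D : ℕ) : ℝ) ≤ ((S * ((D + (S - 1)) / S) : ℕ) : ℝ) := by exact_mod_cast hceil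
  push_cast at h'
  nlinarith

end Summit.RiemannHypothesis.RiemannHypothesis.Theorems.ThetaTier2
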